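import Mathlib
import Literature.NumberTheory.Transcendental.LandauDefectLatticeTate
import Summits.KontsevichZagierPeriods.KontsevichZagierPeriods.Theses.InverseLandau
import Summits.KontsevichZagierPeriods.KontsevichZagierPeriods.Theorems.InverseLandauInverseLandauRationalCurvesHorizontalClassification
import Summits.KontsevichZagierPeriods.KontsevichZagierPeriods.Theorems.InverseLandauInverseLandauRationalCurvesConstantsAlgebraic
import Summits.KontsevichZagierPeriods.KontsevichZagierPeriods.Theorems.InverseLandauInverseLandauRationalCurvesHermiteData
import Summits.KontsevichZagierPeriods.KontsevichZagierPeriods.Theorems.InverseLandauInverseLandauRationalCurvesResidualVanishing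
import Summits.KontsevichZagierPeriods.KontsevichZagierPeriods.Theorems.InverseLandauInverseLandauRationalCurvesTateExpansionCalculus
import Summits.KontsevichZagierPeriods.KontsevichZagierPeriods.Theorems.InverseLandauInverseLandauRationalCurvesTransport
import Summits.KontsevichZagierPeriods.KontsevichZagierPeriods.Theorems.InverseLandauInverseLandauRationalCurvesKernelFinal

/-!
# Crux `InverseLandauRationalCurves` (item stmt-KontsevichZagierPeriods-13872) — PROVED, line `Sketch`

Inverse Landau in dimension one (Tate family `P/Q`, `Q(z,0) = c₀ ≠ 0`, `∫₀¹` of the `ϖ`-expansion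
vanishing termwise ⇒ over every algebraically closed `K ⊇ k(ϖ)`: `F = E′ + Σ_q c_q Σ_p n_{q,p}/(z-p)`,
`E` regular at `0,1` with `E(1) = E(0)`, every `n_q` an exact relation among the `g_p = (p-1)/p`).
This file proves the lead's stub `stub_kernel` (kernel theorem over a finite Galois `K′ ⊇ k(ϖ)`
splitting `Q`, from the five worker stubs as hypotheses verbatim; log-free: period functional with
values in `K′ ⊗_{k(ϖ)} k((ϖ))`, Gauss–Manin horizontality, horizontal descent + Rosenlicht Prop. 4,
`Λ′ = Λ` at the Tate point, trace-and-order) and assembles the crux (`InverseLandauRationalCurves_of`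
= `stub_transport ∘ stub_kernel(…)`; `inverseLandauRationalCurves_proof` has the route declaration as
its type). Crux ideas: `gauss-manin-orbit-rosenlicht`, `silent-logarithms`, `compositum-logs-ax-schanuel`.
-/

noncomputable section

open Polynomial TensorProduct
open scoped LaurentSeries RatFunc
open Literature.NumberTheory.Transcendental Literature.NumberTheory.Transcendental.AyoubRel

namespace Summit.KontsevichZagierPeriods.InverseLandau.RationalCurves

/-- The `D`-image of `Q_{K′}` is the image of `∂Q/∂ϖ` (coefficientwise `d/dϖ`). -/
theorem sum_monomial_QK_eq {k : Type*} [Field k] [CharZero k] (T : TateFamily₁ k) {K' : Type*}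
    [Field K'] [Algebra k K'] [Algebra (RatFunc k) K'] [IsScalarTower k (RatFunc k) K']
    (D₀ : Derivation k (RatFunc k) (RatFunc k))
    (hD₀ : ∀ p : k[X], D₀ (algebraMap k[X] (RatFunc k) p) =
      algebraMap k[X] (RatFunc k) (derivative p))
    (D : Derivation k K' K')
    (hD : ∀ x : RatFunc k, D (algebraMap (RatFunc k) K' x) = algebraMap (RatFunc k) K' (D₀ x)) :
    ((TateFamily₁.toParamPoly T.Q).map (algebraMap (RatFunc k) K')).sum
        (fun j a => monomial j (D a)) =
      ∑ l ∈ (T.Q.eval₂ (mapRingHom (C : k →+* k[X])) (C X)).support,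
        C (algebraMap (RatFunc k) K' (algebraMap k[X] (RatFunc k)
          (derivative ((T.Q.eval₂ (mapRingHom (C : k →+* k[X])) (C X)).coeff l)))) * X ^ l := by
  ext l
  rw [coeff_sum_monomial D (map_zero D), coeff_map, coeff_toParamPoly, hD, hD₀, finsetSum_coeff]
  simp only [coeff_C_mul_X_pow]
  rw [Finset.sum_ite_eq]
  split_ifs with h
  · rfl
  · rw [Polynomial.notMem_support_iff.1 h, derivative_zero, map_zero, map_zero]

/-- **The kernel theorem over a splitting field** (lead's stub `stub_kernel`): from the five
worker statements (hypotheses, verbatim), the crux's conclusion over any finite Galois extension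
`K′ ⊇ k(ϖ)` in which `Q` splits. -/
theorem stub_kernel
    (hE : ∀ {k₁ K : Type} [Field k₁] [CharZero k₁] [Field K] [Algebra k₁ K]
      (D : Derivation k₁ K K)
      (_hconst : ∀ x : K, D x = 0 → x ∈ Set.range (algebraMap k₁ K))
      (_hDer : ∀ δ : Derivation k₁ K K, ∃ f : K, ∀ x, δ x = f * D x)
      {ι : Type} [Fintype ι] (g : ι → Kˣ)
      (N : Submodule K (K × (ι → K)))
      (_hN : ∀ v ∈ N,
        ((D v.1 + ∑ i, v.2 i * ((g i : K)⁻¹ * D (g i)), fun i => D (v.2 i)) : K × (ι → K)) ∈ N)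
      (_hline : ∀ b : K, ((b, 0) : K × (ι → K)) ∈ N → b = 0),
      ∃ s : Finset (K × (ι → K)), (↑s : Set (K × (ι → K))) ⊆ N ∧
        Submodule.span K (↑s : Set (K × (ι → K))) = N ∧
        ∀ v ∈ s, (∃ w : ι → k₁, (∀ i, v.2 i = algebraMap k₁ K (w i)) ∧
            w ∈ Submodule.span k₁ ((fun n : ι → ℤ => fun i => ((n i : ℤ) : k₁)) ''
              (Landau.defectLattice k₁ g : Set (ι → ℤ)))) ∧
          D v.1 + ∑ i, v.2 i * ((g i : K)⁻¹ * D (g i)) = 0)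
    (hC : ∀ {k K : Type} [Field k] [CharZero k] [Field K] [Algebra k K] [Algebra (RatFunc k) K]
      [IsScalarTower k (RatFunc k) K] [Algebra.IsAlgebraic (RatFunc k) K]
      (D : Derivation k K K) (_hD : D (algebraMap (RatFunc k) K RatFunc.X) = 1)
      {x : K} (_hx : D x = 0), IsAlgebraic k x)
    (hPF : ∀ {L : Type} [Field L] [CharZero L] [DecidableEq L] (F : RatFunc L) (_hF : F.denom.Splits),
      ∃ (M : L[X]) (n : ℕ) (a : L → L), (∀ x, x ∉ F.denom.rootSet L → a x = 0) ∧
        F = algebraMap L[X] (RatFunc L) (derivative M * F.denom - n • (M * derivative F.denom)) /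
              algebraMap L[X] (RatFunc L) (F.denom ^ (n + 1)) +
            ∑ p ∈ F.denom.roots.toFinset, RatFunc.C (a p) * (RatFunc.X - RatFunc.C p)⁻¹)
    (hF : ∀ {k : Type} [Field k] (T : TateFamily₁ k) {K : Type} [Field K] [DecidableEq K] [Algebra k K]
      [Algebra (RatFunc k) K] [IsScalarTower k (RatFunc k) K]
      (c : Landau.Place k K) (_hϖ : c.val (algebraMap (RatFunc k) K RatFunc.X) < 1)
      (_hsplit : ((TateFamily₁.toParamPoly T.Q).map (algebraMap (RatFunc k) K)).Splits)
      (a : K → K) (_ha : ∀ x, c.val (a x) ≤ 1) (i : ℕ),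
      c.val ((∑ p ∈ ((TateFamily₁.toParamPoly T.Q).map (algebraMap (RatFunc k) K)).roots.toFinset,
        a p • (((TateFamily₁.toParamPoly T.Q).map (algebraMap (RatFunc k) K)) /ₘ (X - C p))).coeff
          i) < 1)
    (hFC : ∀ {k : Type} [Field k] [CharZero k] (T : TateFamily₁ k) (u : PowerSeries (Polynomial k))
      (_hu : (T.Q : PowerSeries (Polynomial k)) * u = 1) (J : ℕ → ℕ → k⸨X⸩)
      (_hJ : ∀ i m : ℕ, J i m = ((PowerSeries.mk fun n =>
        (PowerSeries.coeff n (PowerSeries.C (X ^ i : Polynomial k) * u ^ m)).sum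
          fun j a => a / ((j : k) + 1) : PowerSeries k) : k⸨X⸩))
      (Qs Ps : Polynomial (Polynomial k))
      (_hQs : Qs = Polynomial.eval₂ (Polynomial.mapRingHom (Polynomial.C : k →+* Polynomial k))
        (C X) T.Q)
      (_hPs : Ps = Polynomial.eval₂ (Polynomial.mapRingHom (Polynomial.C : k →+* Polynomial k))
        (C X) T.P),
      (∀ i m : ℕ, ∑ l ∈ Qs.support, ((Qs.coeff l : PowerSeries k) : k⸨X⸩) * J (i + l) (m + 1) =
          J i m) ∧
      (∀ i m : ℕ, LaurentSeries.derivative k (J i m) =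
          -(m : k⸨X⸩) * ∑ l ∈ Qs.support,
            ((derivative (Qs.coeff l) : PowerSeries k) : k⸨X⸩) * J (i + l) (m + 1)) ∧
      (∀ i n : ℕ, (i : k⸨X⸩) * J (i - 1) n -
          (n : k⸨X⸩) * ∑ l ∈ (derivative Qs).support,
            (((derivative Qs).coeff l : PowerSeries k) : k⸨X⸩) * J (i + l) (n + 1) =
          ((algebraMap (Polynomial k) (RatFunc k) (T.Q.map (evalRingHom 1)))⁻¹ ^ n : RatFunc k) -
            (if i = 0 then
              (((algebraMap (Polynomial k) (RatFunc k) (T.Q.map (evalRingHom 0)))⁻¹ ^ n :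
                RatFunc k) : k⸨X⸩) else 0)) ∧
      (∀ G : PowerSeries (Polynomial k), (T.Q : PowerSeries (Polynomial k)) * G = T.P →
        (∀ j : ℕ, (PowerSeries.coeff j G).sum (fun i a => a / ((i : k) + 1)) = 0) →
        ∑ i ∈ Ps.support, ((Ps.coeff i : PowerSeries k) : k⸨X⸩) * J i 1 = 0))
    (k : Type) [Field k] [CharZero k] (T : TateFamily₁ k) (G : PowerSeries (Polynomial k))
    (hG : (T.Q : PowerSeries (Polynomial k)) * G = (T.P : PowerSeries (Polynomial k)))
    (hint : ∀ j : ℕ, (PowerSeries.coeff j G).sum (fun i a => a / ((i : k) + 1)) = 0)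
    (K' : Type) [Field K'] [Algebra (RatFunc k) K'] [FiniteDimensional (RatFunc k) K']
    [IsGalois (RatFunc k) K']
    (hsplitQ : ((TateFamily₁.toParamPoly T.Q).map (algebraMap (RatFunc k) K')).Splits) :
    ∃ (A B : Polynomial K') (s : ℕ) (c : Fin s → K')
        (nv : Fin s → (landauSet K' T.toRatFunc → ℤ)),
      B.eval 0 ≠ 0 ∧ B.eval 1 ≠ 0 ∧ A.eval 1 * B.eval 0 = A.eval 0 * B.eval 1 ∧
      (∀ q, nv q ∈ Landau.relationLattice (landauDatum K' T.toRatFunc)) ∧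
      algebraMap (Polynomial K') (RatFunc K')
          ((TateFamily₁.toParamPoly T.P).map (algebraMap (RatFunc k) K')) /
        algebraMap (Polynomial K') (RatFunc K')
          ((TateFamily₁.toParamPoly T.Q).map (algebraMap (RatFunc k) K')) =
      algebraMap (Polynomial K') (RatFunc K') (derivative A * B - A * derivative B) /
        algebraMap (Polynomial K') (RatFunc K') (B ^ 2) +
      ∑ q, RatFunc.C (c q) * ∑ p : landauSet K' T.toRatFunc,
        RatFunc.C ((nv q p : ℤ) : K') * (RatFunc.X - RatFunc.C (p : K'))⁻¹ := by
  classical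
  letI : Algebra k K' := ((algebraMap (RatFunc k) K').comp (algebraMap k (RatFunc k))).toAlgebra
  haveI : IsScalarTower k (RatFunc k) K' := IsScalarTower.of_algebraMap_eq fun _ => rfl
  letI : Algebra k[X] K' := ((algebraMap (RatFunc k) K').comp (algebraMap k[X] (RatFunc k))).toAlgebra
  haveI : IsScalarTower k[X] (RatFunc k) K' := IsScalarTower.of_algebraMap_eq fun _ => rfl
  haveI : Algebra.IsSeparable (RatFunc k) K' := IsGalois.to_isSeparable
  haveI : CharZero K' :=
    charZero_of_injective_algebraMap (algebraMap (RatFunc k) K').injective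
  set ι := algebraMap (RatFunc k) K' with hιdef
  set QK : K'[X] := (TateFamily₁.toParamPoly T.Q).map ι with hQK
  set PK : K'[X] := (TateFamily₁.toParamPoly T.P).map ι with hPK
  set S := landauSet K' T.toRatFunc with hS
  have hQ : algebraMap K'[X] (RatFunc K') QK ≠ 0 := algebraMap_QK_ne_zero T
  have hQne : QK ≠ 0 := fun h => hQ (by rw [h, map_zero])
  have hQ0 : QK.eval 0 ≠ 0 := eval_zero_QK_ne_zero T
  have hQ1 : QK.eval 1 ≠ 0 := eval_one_QK_ne_zero T
  have hroot : ∀ p : S, QK.IsRoot (p : K') := fun p => isRoot_QK_of_mem_landauSet T p.2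
  obtain ⟨u₀, hu₀⟩ : IsUnit (C T.c₀ : k[X]) := isUnit_C.2 (isUnit_iff_ne_zero.2 T.c₀_ne_zero)
  set u : PowerSeries k[X] := PowerSeries.invOfUnit (T.Q : PowerSeries k[X]) u₀ with hudef
  have hu : (T.Q : PowerSeries k[X]) * u = 1 := by
    refine PowerSeries.mul_invOfUnit _ u₀ ?_
    rw [hu₀, ← PowerSeries.coeff_zero_eq_constantCoeff_apply, Polynomial.coeff_coe, T.coeff_Q_zero]
  set Qs : Polynomial (Polynomial k) :=
    Polynomial.eval₂ (Polynomial.mapRingHom (Polynomial.C : k →+* Polynomial k)) (C X) T.Q with hQs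
  set Ps : Polynomial (Polynomial k) :=
    Polynomial.eval₂ (Polynomial.mapRingHom (Polynomial.C : k →+* Polynomial k)) (C X) T.P with hPs
  set J : ℕ → ℕ → k⸨X⸩ := fun i m =>
    ((PowerSeries.mk fun n =>
        (PowerSeries.coeff n (PowerSeries.C (X ^ i : Polynomial k) * u ^ m)).sum
          fun j a => a / ((j : k) + 1) : PowerSeries k) : k⸨X⸩) with hJdef
  obtain ⟨hJa, hJb, hJc, hJh⟩ := hFC T u hu J (fun _ _ => rfl) Qs Ps rfl rfl
  have hJps : ∀ (i m : ℕ) (n : ℤ), n < 0 → (J i m).coeff n = 0 := fun i m n hn =>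
    laurent_coeff_coe_powerSeries_neg _ hn
  have hJP := hJh G hG hint
  obtain ⟨I, hI⟩ := exists_periodFunctional (K' := K') J
  obtain ⟨D₀, D, hD₀, hD₀L, hDK₀, hDX⟩ := kernel_deriv_pack (k := k) (K := K')
  obtain ⟨DL, hDL⟩ := exists_tensorDerivation D₀ hD₀L D hDK₀
  obtain ⟨τ, hτ⟩ := exists_traceFunctional (k := k) (K' := K')
  obtain ⟨dz, dc, hdz, hdc, -⟩ := kernel_gm_pack (k := k) D
  have hDQ := sum_monomial_QK_eq T D₀ hD₀ D hDK₀
  have hex : ∃ c : Landau.Place k K', c.val (algebraMap (RatFunc k) K' RatFunc.X) < 1 :=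
    Landau.Place.exists_val_X_lt_one k K'
  let InN : K' → (S → K') → Prop := fun b a => ∃ (N : K'[X]) (m : ℕ) (M : K'[X]) (n : ℕ),
    I m N = 0 ∧
    algebraMap K'[X] (RatFunc K') N / algebraMap K'[X] (RatFunc K') (QK ^ m) =
      dz (algebraMap K'[X] (RatFunc K') M / algebraMap K'[X] (RatFunc K') (QK ^ n)) +
      ∑ i, RatFunc.C (a i) * (RatFunc.X - RatFunc.C ((i : S) : K'))⁻¹ ∧
    b = M.eval 1 / QK.eval 1 ^ n - M.eval 0 / QK.eval 0 ^ n
  have hInN : ∀ (b : K') (a : S → K'), InN b a ↔ ∃ (N : K'[X]) (m : ℕ) (M : K'[X]) (n : ℕ),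
    I m N = 0 ∧
    algebraMap K'[X] (RatFunc K') N / algebraMap K'[X] (RatFunc K') (QK ^ m) =
      dz (algebraMap K'[X] (RatFunc K') M / algebraMap K'[X] (RatFunc K') (QK ^ n)) +
      ∑ i, RatFunc.C (a i) * (RatFunc.X - RatFunc.C ((i : S) : K'))⁻¹ ∧
    b = M.eval 1 / QK.eval 1 ^ n - M.eval 0 / QK.eval 0 ^ n := fun _ _ => Iff.rfl
  let 𝒩 : Submodule K' (K' × (S → K')) :=
    { carrier := {v | InN v.1 v.2}
      zero_mem' := InN_zero T I dz (fun p : S => (p : K')) InN hInN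
      add_mem' := fun {v w} hv hw => InN_add T J I hI hJa dz (fun p : S => (p : K')) InN hInN hv hw
      smul_mem' := fun c v hv => by
        change InN (c * v.1) (c • v.2)
        exact InN_smul T I dz hdz (fun p : S => (p : K')) InN hInN hv c }
  have hmem𝒩 : ∀ v : K' × (S → K'), v ∈ 𝒩 ↔ InN v.1 v.2 := fun _ => Iff.rfl
  set k' := algebraicClosure k K' with hk'
  have hDk' : ∀ a : k', D (a : K') = 0 := fun a =>
    derivation_eq_zero_of_isAlgebraic (F := k) D (fun c => D.map_algebraMap c)
      (mem_algebraicClosure_iff.1 a.2)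
  let D' : Derivation k' K' K' :=
    { toFun := D
      map_add' := map_add D
      map_smul' := fun a x => by
        rw [RingHom.id_apply, Algebra.smul_def, Algebra.smul_def, Derivation.leibniz, smul_eq_mul,
          smul_eq_mul]
        change _ + x * D (a : K') = _
        rw [hDk', mul_zero, add_zero]
      map_one_eq_zero' := D.map_one_eq_zero
      leibniz' := fun x y => D.leibniz x y }
  have hD' : ∀ x, D' x = D x := fun _ => rfl
  have hconst : ∀ x : K', D' x = 0 → x ∈ Set.range (algebraMap k' K') := fun x hx =>
    ⟨⟨x, mem_algebraicClosure_iff.2 (hC D hDX hx)⟩, rfl⟩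
  have hDer : ∀ δ : Derivation k' K' K', ∃ f : K', ∀ x, δ x = f * D' x := fun δ =>
    ⟨δ (algebraMap (RatFunc k) K' RatFunc.X), fun x =>
      derivation_eq_smul (k := k) D hDX (δ.restrictScalars k) x⟩
  set g : S → K'ˣ := landauDatum K' T.toRatFunc with hg
  have hgval : ∀ i : S, (g i : K') = ((i : K') - 1) / i := fun i => val_landauDatum T i
  have hN : ∀ v ∈ 𝒩,
      ((D' v.1 + ∑ i, v.2 i * ((g i : K')⁻¹ * D' (g i)), fun i => D' (v.2 i)) : K' × (S → K')) ∈ 𝒩 := by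
    intro v hv
    rw [hmem𝒩] at hv ⊢
    have := InN_nabla T J I hI hJa dz hdz (fun p : S => (p : K')) InN hInN D dc hdc DL hDL hJb hDQ
      hroot hv
    simp only [hD', hgval]
    exact this
  have hline : ∀ b : K', ((b, 0) : K' × (S → K')) ∈ 𝒩 → b = 0 := fun b hb =>
    InN_line T J I hI hJa dz hdz (fun p : S => (p : K')) InN hInN hJc ((hmem𝒩 _).1 hb)
  obtain ⟨s, hsN, hspan, hgen⟩ := hE D' hconst hDer g 𝒩 hN hline
  obtain ⟨c₀, hc₀⟩ := hex
  have hΛ : Landau.defectLattice k' g = Landau.relationLattice g := by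
    rw [Landau.defectLattice_eq_of_isAlgebraic (k := k) k' g]
    exact landauDefectLattice_eq_relationLattice T.toRatFunc c₀
      (fun p => T.one_lt_val_of_mem_landauSet c₀ hc₀ p.2)
  have hgen' : ∀ v ∈ s, v.1 = 0 ∧ v.2 ∈ Submodule.span K'
      ((fun n : S → ℤ => fun i => ((n i : ℤ) : K')) '' (Landau.relationLattice g : Set (S → ℤ))) := by
    intro v hv
    obtain ⟨⟨w, hw, hwΛ⟩, hdag⟩ := hgen v hv
    rw [hΛ] at hwΛ
    have hv2 : v.2 = fun i => algebraMap k' K' (w i) := funext hw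
    refine ⟨?_, by rw [hv2]; exact map_mem_span_image hwΛ⟩
    have hsum0 : ∑ i, v.2 i * ((g i : K')⁻¹ * D' (g i)) = 0 := by
      rw [hv2]; exact sum_dlog_eq_zero_of_mem_span D' g hwΛ
    rw [hsum0, add_zero] at hdag
    obtain ⟨κ, hκ⟩ := hconst _ hdag
    by_contra hne
    have hvN : v ∈ 𝒩 := hsN hv
    have h1N : ((1 : K'), (v.1)⁻¹ • v.2) ∈ 𝒩 := by
      have := 𝒩.smul_mem (v.1)⁻¹ hvN
      rwa [Prod.smul_mk, smul_eq_mul, inv_mul_cancel₀ hne] at this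
    rw [hmem𝒩] at h1N
    set a : S → K' := (v.1)⁻¹ • v.2 with ha
    have halg : ∀ i, IsAlgebraic k (a i) := fun i => by
      have h1 : IsAlgebraic k v.1 := by rw [← hκ]; exact mem_algebraicClosure_iff.1 κ.2
      have h2 : IsAlgebraic k (v.2 i) := by rw [hw i]; exact mem_algebraicClosure_iff.1 (w i).2
      rw [ha, Pi.smul_apply, smul_eq_mul]
      exact h1.inv.mul h2
    refine InN_one_false T J I hI hJa dz hdz (fun p : S => (p : K')) InN hInN hroot hJc hJps τ hτ
      ⟨c₀, hc₀⟩ (fun c hc i₀ => ?_) h1N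
    let a' : K' → K' := fun x => if hx : x ∈ S then a ⟨x, hx⟩ else 0
    have ha'val : ∀ x, c.val (a' x) ≤ 1 := by
      intro x
      by_cases hx : x ∈ S
      · simp only [a', dif_pos hx]
        by_cases h0 : a ⟨x, hx⟩ = 0
        · rw [h0, Valuation.map_zero]; exact zero_le
        · exact (c.val_eq_one_of_isAlgebraic (halg _) h0).le
      · simp only [a', dif_neg hx, Valuation.map_zero]; exact zero_le
    have hsub : S.toFinset ⊆ QK.roots.toFinset := fun x hx => by
      rw [Multiset.mem_toFinset, mem_roots hQne]
      exact isRoot_QK_of_mem_landauSet T (Set.mem_toFinset.1 hx)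
    have hsum : (∑ p ∈ QK.roots.toFinset, a' p • (QK /ₘ (X - C p))) =
        ∑ i : S, a i • (QK /ₘ (X - C (i : K'))) := by
      rw [← Finset.sum_subset hsub (fun x _ hx => by
        simp only [a', dif_neg (fun h => hx (Set.mem_toFinset.2 h)), zero_smul]),
        Finset.sum_subtype S.toFinset (fun x => Set.mem_toFinset)]
      refine Finset.sum_congr rfl fun i _ => ?_
      simp only [a', dif_pos i.2, Subtype.coe_eta]
    have := hF T c hc hsplitQ a' ha'val i₀
    rw [hsum] at this
    exact this
  have hQ'ne : TateFamily₁.toParamPoly T.Q ≠ 0 := fun h => hQne (by rw [hQK, h, Polynomial.map_zero])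
  have hcross₀ : T.toRatFunc.num * TateFamily₁.toParamPoly T.Q =
      TateFamily₁.toParamPoly T.P * T.toRatFunc.denom :=
    (RatFunc.num_mul_eq_mul_denom_iff hQ'ne).2 rfl
  set FK : RatFunc K' := algebraMap K'[X] (RatFunc K') PK / algebraMap K'[X] (RatFunc K') QK
    with hFK
  have hFK' : FK = algebraMap K'[X] (RatFunc K') (T.toRatFunc.num.map ι) /
      algebraMap K'[X] (RatFunc K') (T.toRatFunc.denom.map ι) := by
    have hd : algebraMap K'[X] (RatFunc K') (T.toRatFunc.denom.map ι) ≠ 0 :=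
      (map_ne_zero_iff _ (IsFractionRing.injective K'[X] (RatFunc K'))).2
        ((Polynomial.map_ne_zero_iff ι.injective).2 T.toRatFunc.denom_ne_zero)
    rw [hFK, div_eq_div_iff hQ hd, ← map_mul, ← map_mul, hPK, hQK, ← Polynomial.map_mul,
      ← Polynomial.map_mul, ← hcross₀, mul_comm]
  have hDn_dvd_Q : FK.denom ∣ QK := RatFunc.denom_div_dvd _ _
  have hDn_dvd_d : FK.denom ∣ T.toRatFunc.denom.map ι := by
    rw [hFK']; exact RatFunc.denom_div_dvd _ _
  have hsplitDn : FK.denom.Splits := Splits.of_dvd hsplitQ hQne hDn_dvd_Q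
  obtain ⟨M₀, n₀, a₀, ha₀, hHer⟩ := hPF FK hsplitDn
  set Dn := FK.denom with hDn
  have hDn0 : Dn ≠ 0 := RatFunc.denom_ne_zero _
  obtain ⟨Cq, hCq⟩ := hDn_dvd_Q
  have hCq0 : Cq ≠ 0 := fun h => hQne (by rw [hCq, h, mul_zero])
  have hexact : algebraMap K'[X] (RatFunc K') (derivative M₀ * Dn - n₀ • (M₀ * derivative Dn)) /
        algebraMap K'[X] (RatFunc K') (Dn ^ (n₀ + 1)) =
      dz (algebraMap K'[X] (RatFunc K') (M₀ * Cq ^ n₀) /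
        algebraMap K'[X] (RatFunc K') (QK ^ n₀)) := by
    rw [← dz_div_pow dz hdz M₀ Dn hDn0 n₀]
    congr 1
    have h1 : algebraMap K'[X] (RatFunc K') (Dn ^ n₀) ≠ 0 :=
      (map_ne_zero_iff _ (IsFractionRing.injective K'[X] (RatFunc K'))).2 (pow_ne_zero _ hDn0)
    have h2 : algebraMap K'[X] (RatFunc K') (QK ^ n₀) ≠ 0 :=
      (map_ne_zero_iff _ (IsFractionRing.injective K'[X] (RatFunc K'))).2 (pow_ne_zero _ hQne)
    rw [div_eq_div_iff h1 h2, ← map_mul, ← map_mul, hCq, mul_pow]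
    congr 1
    ring
  have hsubDn : Dn.roots.toFinset ⊆ S.toFinset := fun x hx => by
    rw [Multiset.mem_toFinset, mem_roots hDn0] at hx
    rw [Set.mem_toFinset, hS, mem_landauSet_iff]
    have : (T.toRatFunc.denom.map ι).IsRoot x := hx.dvd hDn_dvd_d
    rwa [IsRoot.def, eval_map, ← aeval_def] at this
  have hpolar : (∑ p ∈ Dn.roots.toFinset, RatFunc.C (a₀ p) * (RatFunc.X - RatFunc.C p)⁻¹) =
      ∑ i : S, RatFunc.C (a₀ (i : K')) * (RatFunc.X - RatFunc.C (i : K'))⁻¹ := by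
    rw [Finset.sum_subset hsubDn (fun x _ hx => by
      rw [ha₀ x (by rwa [rootSet_def, Finset.mem_coe, aroots_def, Algebra.algebraMap_self,
        Polynomial.map_id]), map_zero, zero_mul]),
      Finset.sum_subtype S.toFinset (fun x => Set.mem_toFinset)]
  have hInN₀ : InN ((M₀ * Cq ^ n₀).eval 1 / QK.eval 1 ^ n₀ - (M₀ * Cq ^ n₀).eval 0 / QK.eval 0 ^ n₀)
      (fun i : S => a₀ (i : K')) := by
    refine ⟨PK, 1, M₀ * Cq ^ n₀, n₀, period_P_eq_zero T J I hI hJP, ?_, rfl⟩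
    rw [pow_one, ← hexact, ← hpolar]
    exact hHer
  have hv₀ : (((M₀ * Cq ^ n₀).eval 1 / QK.eval 1 ^ n₀ - (M₀ * Cq ^ n₀).eval 0 / QK.eval 0 ^ n₀,
      fun i : S => a₀ (i : K')) : K' × (S → K')) ∈ 𝒩 := hInN₀
  rw [← hspan] at hv₀
  obtain ⟨f, -, hf⟩ := Submodule.mem_span_finset.mp hv₀
  have hfst : (M₀ * Cq ^ n₀).eval 1 / QK.eval 1 ^ n₀ - (M₀ * Cq ^ n₀).eval 0 / QK.eval 0 ^ n₀ = 0 := by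
    have h1 := congrArg Prod.fst hf
    simp only [Prod.fst_sum, Prod.smul_fst] at h1
    rw [← h1]
    exact Finset.sum_eq_zero fun v hv => by rw [(hgen' v hv).1, smul_zero]
  have hsnd : (fun i : S => a₀ (i : K')) ∈ Submodule.span K'
      ((fun n : S → ℤ => fun i => ((n i : ℤ) : K')) '' (Landau.relationLattice g : Set (S → ℤ))) := by
    have h2 := congrArg Prod.snd hf
    simp only [Prod.snd_sum, Prod.smul_snd] at h2
    rw [← h2]
    exact Submodule.sum_mem _ fun v hv => Submodule.smul_mem _ _ (hgen' v hv).2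
  obtain ⟨sz, cq, nv, hnv, hcomb⟩ := exists_fin_combination_of_mem_span hsnd
  refine ⟨M₀ * Cq ^ n₀, QK ^ n₀, sz, cq, nv, ?_, ?_, ?_, hnv, ?_⟩
  · rw [eval_pow]; exact pow_ne_zero _ hQ0
  · rw [eval_pow]; exact pow_ne_zero _ hQ1
  · rw [sub_eq_zero, div_eq_div_iff (pow_ne_zero _ hQ1) (pow_ne_zero _ hQ0)] at hfst
    rw [eval_pow, eval_pow]
    exact hfst
  · -- the partial-fraction identity
    have hB : QK ^ n₀ ≠ 0 := pow_ne_zero _ hQne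
    change FK = _
    rw [hHer, hexact, hpolar]
    congr 1
    · rw [show algebraMap K'[X] (RatFunc K') (QK ^ n₀) =
          algebraMap K'[X] (RatFunc K') ((QK ^ n₀) ^ 1) by rw [pow_one],
        dz_div_pow dz hdz _ _ hB 1, one_smul, pow_succ, pow_one]
    · have e : ∀ i : S, RatFunc.C (a₀ (i : K')) =
          ∑ q, RatFunc.C (cq q) * RatFunc.C ((nv q i : ℤ) : K') := fun i => by
        have := congr_fun hcomb i
        simp only [Finset.sum_apply, Pi.smul_apply, smul_eq_mul] at this
        rw [this, map_sum]
        exact Finset.sum_congr rfl fun q _ => by rw [map_mul]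
      simp_rw [e, Finset.sum_mul, mul_assoc]
      rw [Finset.sum_comm]
      refine Finset.sum_congr rfl fun q _ => ?_
      rw [Finset.mul_sum]

/-- **Composition**: the crux `InverseLandauRationalCurves` from the stubs. The kernel theorem is
applied over the splitting field `K′` of `Q` over `k(ϖ)` (finite, and Galois in characteristic
zero), and transported to the given algebraically closed `K`. -/
theorem InverseLandauRationalCurves_of :
    Summit.KontsevichZagierPeriods.KontsevichZagierPeriods.Theses.InverseLandau.InverseLandauRationalCurves := by
  intro k _ _ T G hG hint K _ _ _
  let Q' : Polynomial (RatFunc k) := TateFamily₁.toParamPoly T.Q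
  let K' : Type := Q'.SplittingField
  haveI : Algebra.IsSeparable (RatFunc k) K' := Algebra.IsAlgebraic.isSeparable_of_perfectField
  haveI : IsGalois (RatFunc k) K' := IsGalois.mk
  have hsplitQ : (Q'.map (algebraMap (RatFunc k) K')).Splits := SplittingField.splits Q'
  have hQne : Q'.map (algebraMap (RatFunc k) K') ≠ 0 := fun h =>
    kernel_module_pack T (K' := K') (by rw [h, map_zero])
  have hden : (T.toRatFunc.denom.map (algebraMap (RatFunc k) K')).Splits :=
    Splits.of_dvd hsplitQ hQne (Polynomial.map_dvd _ T.denom_toRatFunc_dvd)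
  exact stub_transport T K' hden (stub_kernel stub_horizontalClassification stub_constantsAlgebraic
    stub_hermiteData stub_residualVanishing stub_tateExpansionCalculus k T G hG hint K' hsplitQ) K

/-- **Crux `InverseLandauRationalCurves` — closing theorem** (its type is literally the route
declaration). -/
theorem inverseLandauRationalCurves_proof :
    Summit.KontsevichZagierPeriods.KontsevichZagierPeriods.Theses.InverseLandau.InverseLandauRationalCurves :=
  InverseLandauRationalCurves_of

end Summit.KontsevichZagierPeriods.InverseLandau.RationalCurves

end
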